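import Summits.Langlands.Langlands.Theorems.NonParallelVoidTwistedInductionParallelSymmetriseDefs
import Summits.Langlands.Langlands.Theorems.NonParallelVoidTwistedInductionParallelStubParallelOfAutomorphicTwist
import Literature.NumberTheory.Automorphic.BLGGT2014PotentialAutomorphy
import Literature.NumberTheory.PAdicHodge.FontainePstInductionSchemata
import Literature.NumberTheory.PAdicHodge.FontainePstLabelledWeightsSchemata
import Literature.NumberTheory.PAdicHodge.FontainePstLabelledWeightsDetSchema
import Literature.NumberTheory.GaloisRepresentations.PotentialDiagonalizabilityPermanence
import Literature.NumberTheory.GaloisRepresentations.InducedSymplectic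
import Literature.NumberTheory.GaloisRepresentations.InducedAEUnramified
import Literature.NumberTheory.GaloisRepresentations.LAdicCharacterUnramifiedAEProofs
import Literature.NumberTheory.GaloisRepresentations.ArtinRepCoefficientTransport
import Literature.NumberTheory.GaloisRepresentations.ToLocalRestrictField
import Literature.NumberTheory.GaloisRepresentations.PadicAlgebraDegreeOnePlace
import Literature.NumberTheory.GaloisRepresentations.FramedRepTwistTraceLocalProofs
import Literature.NumberTheory.GaloisRepresentations.PstWeilDeligneTwistDeRham
import Literature.NumberTheory.PAdicHodge.LocallyCyclotomicCharacterDeRham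
import Literature.NumberTheory.PAdicHodge.DeRhamBaseChangeProofs
import HarnessLib

/-!
# Route `NonParallelVoid`, crux `TwistedInductionParallel` (stmt-Langlands-17000), line `symmetrise-pd-split`:
# stub 3 `stub_potentialAutomorphyOfInducedTwist` — BLGGT Theorem C applied to the induced twist

Lead prover `prover-line-stmt-Langlands-17000-0`, 2026-08-17.  From a symmetrising datum
(`SymmetrisingTwistDatumLA`: totally real `K`, CM quadratic `E/K` over `F`, `χ` locally algebraic above `p`,
`det(ρ|_E ⊗ χ) = θ|_E` with `θ = θ₀ ε^t` totally odd, `Ind_E^K(ρ|_E ⊗ χ)|K(ζ_p)` residually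
absolutely irreducible) the induced twist `I = Ind_{Γ_E}^{Γ_K}(ρ|_E ⊗ χ)` satisfies the hypotheses
of the accepted named fact `BLGGT2014_thmC_potentialAutomorphy` (`n = 4`, `l = p ≥ 11 ≥ 10`):
(1) a.e. unramified (`InducedAEUnramified`); (2) symplectic with totally odd multiplier `θ`
(`InducedSymplectic`); (3) at every `v ∣ p` of `K`: de Rham and potentially diagonalizable (named
schemata `IsDeRhamFramedInduceSchema`, `PDRestrictSchema`, `PDTwistSchema`, `PDInduceSchema`, with the
proved `DeRhamBaseChange_holds` and `IsDeRhamFramed.twist_det`), with FOUR DISTINCT labelled weights —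
the two weight pairs of `W = ρ|_E ⊗ χ` at the two labels of `E` above a label `τ` of `K`
(`LabelledWeightsInduceSchema`) are `{a + c, b + c}` and `{a' + c', b' + c'}` where `{a, b}`, `{a', b'}`
are the weights of `ρ` at the two (conjugate, hence DISTINCT, `F` totally complex ⊄ `K` totally real)
labels of `F` below (`labelledHodgeTateWeightsAtLabel_twist_restrictField`, stub-4 file), CONCENTRIC
(`det W = θ|_E`: `LabelledWeightsDetSchema` + `LabelledWeightsRestrictSchema`) and of DIFFERENT gaps
(`NonParallelPair` + uniqueness of the label at a split place, `PadicAlgebraDegreeOnePlace`); (4) verbatim.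
The conclusion is repackaged as the waypoint `InducedTwistAutomorphic`.
-/

noncomputable section

open scoped NumberField
open NumberField IsDedekindDomain Field Filter ValuativeRel
open Literature.NumberTheory.GaloisRepresentations Literature.NumberTheory.PAdicHodge
open Literature.NumberTheory.Automorphic

-- `Summit.Langlands.Langlands.…` repeats a namespace component by design (D-0017 nested layout).
set_option linter.dupNamespace false

namespace Summit.Langlands.Langlands.Cruxes.TwistedInductionParallel.SymmetrisePdSplit



/-! ## 1. Hypothesis (2): odd symplectic -/

section Symplectic

variable {K : Type} [Field K] {p : ℕ} [Fact p.Prime]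

/-- A totally odd `θ` (oddness of its rank-one framed avatar `θ · 1`) takes the value `-1` at
every complex conjugation. [folklore] -/
theorem apply_eq_neg_one_of_isOdd_scalar_comp {θ : absoluteGaloisGroup K →ₜ* (PadicAlgCl p)ˣ}
    (hodd : FramedGaloisRep.IsOdd
      ((FramedRep.scalar (PadicAlgCl p) 1).comp θ : FramedGaloisRep K (PadicAlgCl p) 1))
    (φ : K →+* ℝ) (c : absoluteGaloisGroup K) (hc : IsComplexConjugation φ c) :
    θ.toMonoidHom c = -1 := by
  have h := hodd φ c hc
  have hdet : Matrix.GeneralLinearGroup.det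
      (((FramedRep.scalar (PadicAlgCl p) 1).comp θ : FramedGaloisRep K (PadicAlgCl p) 1) c) = θ c := by
    ext
    rw [Matrix.GeneralLinearGroup.val_det_apply, ContinuousMonoidHom.comp_toFun,
      FramedRep.coe_scalar_apply, Matrix.det_fin_one, Matrix.algebraMap_matrix_apply, if_pos rfl,
      Algebra.algebraMap_self, RingHom.id_apply]
  rw [hdet] at h
  exact h

end Symplectic

/-! ## 2. Two `K`-embeddings of `E` which differ, differ on `F` -/

section Embeddings

/-- **Two distinct embeddings `E → Ω` which agree on `K` disagree on `F`**, for a quadratic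
extension `E/K` of a totally real `K` containing a totally complex `F`: their equaliser is a proper
intermediate field of the quadratic `E/K`, hence `K` itself, which cannot contain (a copy of) the
totally complex `F`. [folklore] -/
theorem ringHom_comp_ne_of_ne {F K E Ω : Type} [Field F] [NumberField F] [IsTotallyComplex F]
    [Field K] [NumberField K] [IsTotallyReal K] [Field E] [NumberField E] [Field Ω]
    [Algebra F E] [Algebra K E] (hd : Module.finrank K E = 2) {σ₀ σ₁ : E →+* Ω} (hne : σ₀ ≠ σ₁)
    (hK : σ₀.comp (algebraMap K E) = σ₁.comp (algebraMap K E)) :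
    σ₀.comp (algebraMap F E) ≠ σ₁.comp (algebraMap F E) := by
  intro hF
  classical
  letI : Algebra K Ω := (σ₀.comp (algebraMap K E)).toAlgebra
  let φ₀ : E →ₐ[K] Ω := { σ₀ with commutes' := fun _ => rfl }
  let φ₁ : E →ₐ[K] Ω := { σ₁ with commutes' := fun r => (RingHom.congr_fun hK r).symm }
  let S : IntermediateField K E := (AlgHom.equalizer φ₀ φ₁).toIntermediateField fun x hx => by
    rw [AlgHom.mem_equalizer] at hx ⊢
    change σ₀ x⁻¹ = σ₁ x⁻¹
    have hx' : σ₀ x = σ₁ x := hx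
    rw [map_inv₀, map_inv₀, hx']
  have hmemS : ∀ x : E, x ∈ S ↔ σ₀ x = σ₁ x := fun x => AlgHom.mem_equalizer φ₀ φ₁ x
  haveI := IntermediateField.isSimpleOrder_of_finrank_prime K E (by rw [hd]; exact Nat.prime_two)
  rcases IsSimpleOrder.eq_bot_or_eq_top S with hS | hS
  · -- `S = K`: then `F` embeds into the totally real `K`
    have hmem : ∀ x : F, algebraMap F E x ∈ (⊥ : IntermediateField K E) := fun x => by
      rw [← hS, hmemS]
      exact RingHom.congr_fun hF x
    let f₀ : F →+* (⊥ : IntermediateField K E) := (algebraMap F E).codRestrict _ hmem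
    let f : F →+* K := (IntermediateField.botEquiv K E).toRingEquiv.toRingHom.comp f₀
    letI : Algebra F K := f.toAlgebra
    haveI : IsScalarTower ℚ F K := IsScalarTower.of_algebraMap_eq fun r => by
      change algebraMap ℚ K r = f (algebraMap ℚ F r)
      rw [eq_ratCast (algebraMap ℚ F), map_ratCast, eq_ratCast]
    haveI : Algebra.IsAlgebraic F K := Algebra.IsAlgebraic.tower_top (K := ℚ) F
    have hreal : IsTotallyReal F := IsTotallyReal.of_algebra F K
    obtain ⟨w⟩ := (inferInstance : Nonempty (InfinitePlace F))
    exact (InfinitePlace.not_isReal_iff_isComplex.mpr (IsTotallyComplex.isComplex w)) (hreal.isReal w)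
  · -- `S = E`: then `σ₀ = σ₁`
    refine hne (RingHom.ext fun x => (hmemS x).1 ?_)
    rw [hS]
    exact IntermediateField.mem_top

end Embeddings


/-! ## 2b. Local lemmas: determinant of a rank-one avatar; de Rham-ness of `ρ|_E ⊗ χ`;
restriction of labelled weights; the final arithmetic -/

section LocalLemmas

variable {p : ℕ} [Fact p.Prime]

/-- `det (χ · 1) = χ` for the rank-one framed avatar of a character. [folklore] -/
theorem det_scalar_comp {G : Type*} [Group G] [TopologicalSpace G] (χ : G →ₜ* (PadicAlgCl p)ˣ) :
    FramedRep.det ((FramedRep.scalar (PadicAlgCl p) 1).comp χ) = χ := by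
  refine ContinuousMonoidHom.ext fun g => Units.ext ?_
  rw [FramedRep.det_apply, Matrix.GeneralLinearGroup.val_det_apply, ContinuousMonoidHom.comp_toFun,
    FramedRep.coe_scalar_apply, Matrix.det_fin_one, Matrix.algebraMap_matrix_apply, if_pos rfl,
    Algebra.algebraMap_self, RingHom.id_apply]

variable {F E : Type} [Field F] [NumberField F] [Field E] [NumberField E] [Algebra F E]

/-- **`ρ|_{Γ_E} ⊗ χ` is de Rham at every `w ∣ p`** when `ρ` is de Rham at every `v ∣ p` (pinned data;
`DeRhamBaseChange_holds`, proved) and `χ` is a power of the cyclotomic character on inertia above `p`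
(`LocallyCyclotomicCharacterDeRham`), by Fontaine's `⊗`-stability (`IsDeRhamFramed.twist_det`).
[cite: BrinonConrad2009, Prop. 6.3.8] [cite: FontaineAsterisque223III, Exp. III Prop. 1.5.2] -/
theorem isDeRhamFramed_toLocal_twist_restrictField {n : ℕ} (ρ : FramedGaloisRep F (PadicAlgCl p) n)
    (χ : absoluteGaloisGroup E →ₜ* (PadicAlgCl p)ˣ)
    (hρ : ∀ (v : HeightOneSpectrum (𝓞 F)) (hv : ((p : ℕ) : 𝓞 F) ∈ v.asIdeal),
      (fontainePstAdicCompletion v p hv).IsDeRhamFramed (ρ.toLocal v))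
    (hχ : IsLocallyAlgebraicAbove p E χ) (w : HeightOneSpectrum (𝓞 E))
    (hw : ((p : ℕ) : 𝓞 E) ∈ w.asIdeal) :
    (fontainePstAdicCompletion w p hw).IsDeRhamFramed
      (FramedGaloisRep.toLocal w (FramedRep.twist (ρ.restrictField E) χ)) := by
  have h1 := isDeRhamFramed_toLocal_restrictField DeRhamBaseChange_holds ρ hρ w hw
  obtain ⟨k, hk⟩ := hχ w hw
  have h2 := isDeRhamFramed_toLocal_scalar_comp_of_inertia_eq_cyclotomic_zpow χ w hw k hk
  have h3 := PstWeilDeligneData.IsDeRhamFramed.twist_det h1 h2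
  rw [FramedGaloisRep.toLocal_scalar_comp, det_scalar_comp] at h3
  rw [FramedGaloisRep.toLocal_twist]
  exact h3

/-- **Labelled weights are insensitive to restriction along `E/K`, label by label, for the pinned
data** — the accepted `LabelledWeightsRestrictSchema` transported through
`exists_toLocal_restrictField_eq_conj` and frame invariance (the block `h2` of the stub-4 lemma
`labelledHodgeTateWeightsAtLabel_twist_restrictField`, without the twist). [cite: Patrikis2019, §2.7.1] -/
theorem labelledHodgeTateWeightsAtLabel_restrictField_below (hS1 : LabelledWeightsRestrictSchema) {n : ℕ}
    (Θ : FramedGaloisRep F (PadicAlgCl p) n) {w : HeightOneSpectrum (𝓞 E)}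
    {hw : ((p : ℕ) : 𝓞 E) ∈ w.asIdeal} (σ : PinnedLabel p w hw) :
    labelledHodgeTateWeightsAtLabel (Θ.restrictField E) w hw σ =
      labelledHodgeTateWeightsAtLabel Θ (w.under (𝓞 F)) (natCast_mem_under (F := F) hw) (σ.below F) := by
  haveI := LocalField.charZero_adicCompletion w
  haveI := LocalField.charZero_adicCompletion (w.under (𝓞 F))
  haveI := liesOver_under (F := F) w
  letI := (adicCompletionOfLiesOver F E (w.under (𝓞 F)) w).toAlgebra
  obtain ⟨γ, hγ⟩ := exists_toLocal_restrictField_eq_conj Θ (w.under (𝓞 F)) w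
  simp only [labelledHodgeTateWeightsAtLabel, FramedGaloisRep.labelledHodgeTateWeightsAt_def]
  rw [hγ, PstWeilDeligneData.labelledHodgeTateWeights_conj_eq]
  exact hS1 p ((w.under (𝓞 F)).adicCompletion F) (w.adicCompletion E)
    (continuous_adicCompletionOfLiesOver F E (w.under (𝓞 F)) w)
    (LocalField.valuation_adicCompletion_natCast_lt_one (w.under (𝓞 F)) p
      (natCast_mem_under (F := F) hw))
    (LocalField.valuation_adicCompletion_natCast_lt_one w p hw) n (Θ.toLocal (w.under (𝓞 F)))
    (σ.below F) σ (PinnedLabel.toHom_below F σ).symm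

/-- Four integers `A + c, B + c, A' + c', B' + c'` with `A < B`, `A' < B'`, concentric
(`A + B + 2c = A' + B' + 2c'`) and of different gaps are pairwise distinct. [folklore] -/
theorem nodup_of_concentric_of_gap_ne {A B A' B' c c' : ℤ} (hAB : A < B) (hAB' : A' < B')
    (hsum : A + c + (B + c) = A' + c' + (B' + c')) (hgap : B - A ≠ B' - A') :
    ((A + c) ::ₘ (B + c) ::ₘ (A' + c') ::ₘ {B' + c'} : Multiset ℤ).Nodup := by
  simp only [Multiset.nodup_cons, Multiset.mem_cons, Multiset.mem_singleton, Multiset.nodup_singleton,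
    and_true, not_or]
  omega

end LocalLemmas

/-! ## 3. The stub -/

/-- **STUB 3 — BLGGT Theorem C for the induced twist** (registered signature of skeleton v6 of line
`symmetrise-pd-split`; see the module docstring for the proof).
[cite: BarnetlambEtAl2014, Theorem C (= Cor. 4.5.2, Thm. 4.5.1) with §2.1 and §1.4]
[cite: Patrikis2019, Lemma 7.2.1] -/
theorem stub_potentialAutomorphyOfInducedTwist :
    BLGGT2014_thmC_potentialAutomorphy → Literature.NumberTheory.PAdicHodge.FontaineDatumExists →
    IsDeRhamFramedInduceSchema → LabelledWeightsInduceSchema → PDRestrictSchema → PDTwistSchema →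
    PDInduceSchema → LabelledWeightsRestrictSchema → LabelledWeightsTwistSchema →
    LabelledWeightsDetSchema →
    ∀ (F : Type) [Field F] [NumberField F] [Algebra.IsQuadraticExtension ℚ F],
      NumberField.IsTotallyComplex F → ∀ (p : ℕ) [Fact p.Prime] (ρ : FramedGaloisRep F (PadicAlgCl p) 2),
      ρ.toGaloisRep.IsIrreducible →
      (∀ᶠ v : IsDedekindDomain.HeightOneSpectrum (NumberField.RingOfIntegers F) in Filter.cofinite,
        ρ.IsUnramifiedAt v) →
      HasTwoWeights F p ρ → GoodRegime F p ρ → NonParallelPair F p ρ → PDAbove F p ρ →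
      SymmetrisingTwistDatumLA F p ρ → InducedTwistAutomorphic F p ρ := by
  intro hC hFD hI1 hI2 hP1 hP2 hP3 hR hT hD F _ _ _ hFtc p _ ρ _hirr hunr hHT hgood hNP hPD hST
  obtain ⟨K, E, _, _, _, _, _, _, hd, hKtr, hEcm, χ, θ, hLA, hθshape, hdet, hodd, hirrI⟩ := hST
  haveI : IsTotallyReal K := hKtr
  haveI : IsTotallyComplex F := hFtc
  obtain ⟨ι⟩ := PadicAlgCl.nonempty_ringEquiv_complex p
  set W : FramedGaloisRep E (PadicAlgCl p) 2 := FramedRep.twist (ρ.restrictField E) χ with hWdef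
  -- (1) unramified almost everywhere
  have h1 : ∀ᶠ v : HeightOneSpectrum (𝓞 K) in cofinite,
      (FramedGaloisRep.induce K hd W).IsUnramifiedAt v := by
    refine FramedGaloisRep.eventually_isUnramifiedAt_induce K hd W ?_
    exact FramedGaloisRep.eventually_isUnramifiedAt_twist (ρ.restrictField E) χ
      (FramedGaloisRep.eventually_isUnramifiedAt_restrictField ρ hunr)
      (FramedGaloisRep.eventually_isUnramifiedAt_of_rank_one _)
  -- (2) symplectic with totally odd multiplier
  have h2 := FramedGaloisRep.induce_isSymplecticWithMultiplier_of_det_eq K hd W θ hdet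
  obtain ⟨J, hJT, hJdet, hJ⟩ := h2
  -- (3) the local clause
  have h3 : ∀ (v : HeightOneSpectrum (𝓞 K)) (hv : ((p : ℕ) : 𝓞 K) ∈ v.asIdeal),
      (fontainePstAdicCompletion v p hv).IsDeRhamFramed ((FramedGaloisRep.induce K hd W).toLocal v) ∧
      (letI := (fontainePstAdicCompletion v p hv).algebra
       (∀ τ : v.adicCompletion K →ₐ[ℚ_[p]] PadicAlgCl p,
          (let M := (FramedGaloisRep.induce K hd W).labelledHodgeTateWeightsAt v
             (fontainePstAdicCompletion v p hv).algebra
             (fontainePstAdicCompletion v p hv).𝔅 τ.toRingHom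
           M.Nodup ∧ Multiset.card M = 2 * 2)) ∧
       Nonempty (PstCrystallineExtensionData (fontainePstAdicCompletion v p hv)) ∧
       ∀ 𝔈 : PstCrystallineExtensionData (fontainePstAdicCompletion v p hv),
         IsPotentiallyDiagonalizable 𝔈.𝔅 ((FramedGaloisRep.induce K hd W).toLocal v)) := by
    -- de Rham-ness of `W` above `p`
    have hWdR : ∀ (w : HeightOneSpectrum (𝓞 E)) (hw : ((p : ℕ) : 𝓞 E) ∈ w.asIdeal),
        (fontainePstAdicCompletion w p hw).IsDeRhamFramed (W.toLocal w) := fun w hw =>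
      isDeRhamFramed_toLocal_twist_restrictField ρ χ (fun v hv => (hHT v hv).1) hLA w hw
    -- potential diagonalizability of `W` above `p`
    have hWPD : ∀ (w : HeightOneSpectrum (𝓞 E)) (hw : ((p : ℕ) : 𝓞 E) ∈ w.asIdeal)
        (𝔈 : PstCrystallineExtensionData (fontainePstAdicCompletion w p hw)),
        letI := (fontainePstAdicCompletion w p hw).algebra
        IsPotentiallyDiagonalizable 𝔈.𝔅 (W.toLocal w) := fun w hw =>
      hP2 E p 2 (ρ.restrictField E) χ w hw (hLA w hw)
        (hP1 F E p 2 ρ (w.under (𝓞 F)) (natCast_mem_under (F := F) hw) w hw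
          (liesOver_under (F := F) w).over.symm (hPD _ _))
    -- the rank-one avatar of `θ` and the determinant of `W`
    set Θ : FramedGaloisRep K (PadicAlgCl p) 1 := (FramedRep.scalar (PadicAlgCl p) 1).comp θ with hΘdef
    have hΘ : ∀ w : HeightOneSpectrum (𝓞 E),
        (FramedRep.scalar (PadicAlgCl p) 1).comp (FramedRep.det (W.toLocal w)) =
          (Θ.restrictField E).toLocal w := fun w => by
      refine ContinuousMonoidHom.ext fun g => ?_
      have := congrArg (fun f : absoluteGaloisGroup E →ₜ* (PadicAlgCl p)ˣ =>
        f (absGaloisRestrict E (w.adicCompletion E) g)) hdet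
      change FramedRep.scalar (PadicAlgCl p) 1 (FramedRep.det W (absGaloisRestrict E (w.adicCompletion E) g)) =
        FramedRep.scalar (PadicAlgCl p) 1 (θ (absGaloisRestrict K E (absGaloisRestrict E (w.adicCompletion E) g)))
      rw [this]
      rfl
    have hF2 : Module.finrank ℚ F = 2 := Algebra.IsQuadraticExtension.finrank_eq_two (R := ℚ) (S := F)
    intro v hv
    refine ⟨hI1 K E 2 hd p 2 W hWdR v hv, ?_,
      nonempty_pstCrystallineExtensionData_fontainePstAdicCompletion hFD v p hv,
      hP3 K E 2 hd p 2 W hWPD v hv⟩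
    intro τ
    change (labelledHodgeTateWeightsAtLabel (FramedGaloisRep.induce K hd W) v hv τ).Nodup ∧
      Multiset.card (labelledHodgeTateWeightsAtLabel (FramedGaloisRep.induce K hd W) v hv τ) = 2 * 2
    obtain ⟨w, hw, σ, habove, hinj, hM⟩ := hI2 K E 2 hd p 2 W v hv τ
    -- the weights of `W` at the two labels above `τ`: those of `ρ` below, shifted
    have hWi : ∀ i : Fin 2, ∃ c : ℤ, labelledHodgeTateWeightsAtLabel W (w i) (hw i) (σ i) =
        (labelledHodgeTateWeightsAtLabel ρ ((w i).under (𝓞 F)) (natCast_mem_under (F := F) (hw i))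
          ((σ i).below F)).map fun h => h + c := fun i => by
      obtain ⟨k, hk⟩ := hLA (w i) (hw i)
      obtain ⟨c, hc⟩ : ∃ c : ℤ, labelledHodgeTateWeightsAtLabel
          ((FramedRep.scalar (PadicAlgCl p) 1).comp χ : FramedGaloisRep E (PadicAlgCl p) 1)
          (w i) (hw i) (σ i) = {c} :=
        exists_labelledHodgeTateWeightsAt_eq_singleton_of_inertia_eq_cyclotomic_zpow χ (w i) (hw i) k hk
          (σ i)
      exact ⟨c, labelledHodgeTateWeightsAtLabel_twist_restrictField hR hT ρ χ (σ i) c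
        (isDeRhamFramed_toLocal_scalar_comp_of_inertia_eq_cyclotomic_zpow χ (w i) (hw i) k hk) hc⟩
    -- concentricity: the sum of the weights of `W` at `σ i` is the weight of `θ` at `τ`
    have hsum : ∀ i : Fin 2, ({(labelledHodgeTateWeightsAtLabel W (w i) (hw i) (σ i)).sum} : Multiset ℤ) =
        labelledHodgeTateWeightsAtLabel Θ v hv τ := fun i => by
      haveI := LocalField.charZero_adicCompletion (w i)
      have h := hD p ((w i).adicCompletion E)
        (LocalField.valuation_adicCompletion_natCast_lt_one (w i) p (hw i)) 2 (W.toLocal (w i))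
        (hWdR (w i) (hw i)) (σ i)
      rw [hΘ (w i)] at h
      have h' : labelledHodgeTateWeightsAtLabel (Θ.restrictField E) (w i) (hw i) (σ i) =
          {(labelledHodgeTateWeightsAtLabel W (w i) (hw i) (σ i)).sum} := by
        simp only [labelledHodgeTateWeightsAtLabel, FramedGaloisRep.labelledHodgeTateWeightsAt_def]
        exact h
      rw [← h', labelledHodgeTateWeightsAtLabel_restrictField_below hR Θ (σ i)]
      exact labelledHodgeTateWeightsAtLabel_eq_of_emb_eq Θ _ τ
        (by rw [PinnedLabel.emb_below]; exact habove i)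
    have hsum01 : (labelledHodgeTateWeightsAtLabel W (w 0) (hw 0) (σ 0)).sum =
        (labelledHodgeTateWeightsAtLabel W (w 1) (hw 1) (σ 1)).sum :=
      Multiset.singleton_inj.1 ((hsum 0).trans (hsum 1).symm)
    -- the two labels of `F` below have distinct embeddings
    have hℓne : ((σ 0).below F).emb ≠ ((σ 1).below F).emb := by
      rw [PinnedLabel.emb_below, PinnedLabel.emb_below]
      refine ringHom_comp_ne_of_ne (F := F) hd (fun h => ?_) ((habove 0).trans (habove 1).symm)
      exact absurd (hinj h) (by decide)
    -- the non-parallel pair, and the two embeddings of the quadratic `F`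
    obtain ⟨x, hx, y, hy, τx, τy, a, b, a', b', hHx, hab, hHy, hab', hgap⟩ := hNP
    change labelledHodgeTateWeightsAtLabel ρ x hx τx = {a, b} at hHx
    change labelledHodgeTateWeightsAtLabel ρ y hy τy = {a', b'} at hHy
    have hxy : PinnedLabel.emb (p := p) τx ≠ PinnedLabel.emb (p := p) τy := fun h => by
      have := (hHx.symm.trans (labelledHodgeTateWeightsAtLabel_eq_of_emb_eq ρ τx τy h)).trans hHy
      rcases pair_cases (by simpa [Multiset.insert_eq_cons] using this) with ⟨h1, h2⟩ | ⟨h1, h2⟩ <;> omega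
    have hpairs : ∃ A B A' B' : ℤ,
        labelledHodgeTateWeightsAtLabel ρ _ _ ((σ 0).below F) = {A, B} ∧ A < B ∧
        labelledHodgeTateWeightsAtLabel ρ _ _ ((σ 1).below F) = {A', B'} ∧ A' < B' ∧
        B - A ≠ B' - A' := by
      rcases emb_dichotomy hF2 hxy ((σ 0).below F).emb with h0 | h0 <;>
        rcases emb_dichotomy hF2 hxy ((σ 1).below F).emb with h1 | h1
      · exact absurd (h0.trans h1.symm) hℓne
      · exact ⟨a, b, a', b', (labelledHodgeTateWeightsAtLabel_eq_of_emb_eq ρ _ τx h0).trans hHx, hab,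
          (labelledHodgeTateWeightsAtLabel_eq_of_emb_eq ρ _ τy h1).trans hHy, hab', hgap⟩
      · exact ⟨a', b', a, b, (labelledHodgeTateWeightsAtLabel_eq_of_emb_eq ρ _ τy h0).trans hHy, hab',
          (labelledHodgeTateWeightsAtLabel_eq_of_emb_eq ρ _ τx h1).trans hHx, hab, fun h => hgap h.symm⟩
      · exact absurd (h0.trans h1.symm) hℓne
    obtain ⟨A, B, A', B', h0, hAB, h1, hAB', hgapAB⟩ := hpairs
    obtain ⟨c, hc⟩ := hWi 0
    obtain ⟨c', hc'⟩ := hWi 1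
    rw [h0] at hc
    rw [h1] at hc'
    simp only [Multiset.insert_eq_cons, Multiset.map_cons, Multiset.map_singleton] at hc hc'
    rw [hc, hc'] at hsum01
    simp only [Multiset.sum_cons, Multiset.sum_singleton] at hsum01
    rw [hM, Fin.sum_univ_two, hc, hc', Multiset.cons_add, Multiset.singleton_add]
    refine ⟨nodup_of_concentric_of_gap_ne hAB hAB' hsum01 hgapAB, ?_⟩
    simp
  -- Theorem C
  have hp10 : 2 * (2 * 2 + 1) ≤ p := by have := hgood.1; omega
  obtain ⟨K', _, _, _, hGal, hK'tr, hss, hcpt, π, hreg, hcompat⟩ :=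
    hC K hKtr (2 * 2) (by norm_num) p hp10 ι (FramedGaloisRep.induce K hd W) h1
      (Or.inl ⟨J, θ.toMonoidHom, hJT, hJdet, hJ,
        fun φ c hc => apply_eq_neg_one_of_isOdd_scalar_comp hodd φ c hc⟩) h3 hirrI
  exact ⟨K, E, inferInstance, inferInstance, inferInstance, inferInstance, inferInstance,
    inferInstance, hd, hKtr, hEcm, χ, θ, hLA, hθshape, hdet, hirrI, K', inferInstance, inferInstance,
    inferInstance, hGal, hK'tr, ι, hss, hcpt, π, hreg, hcompat⟩

end Summit.Langlands.Langlands.Cruxes.TwistedInductionParallel.SymmetrisePdSplit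

end
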